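import Summits.AtomisticToContinuum.FouriersLaw.Theses.HonestZwanzig
import Literature.Barriers.AtomisticToContinuum.FixedLengthNoConductivityControl

/-!
# Disproof of `OrthogonalOhm` — findings (cdisprove, crux `stmt-AtomisticToContinuum-12693`, cycle 1, 2026-08-16)

Crux: `Summit.AtomisticToContinuum.FouriersLaw.Theses.HonestZwanzig.OrthogonalOhm` (route `HonestZwanzig`,
rank 2).  VERDICT OF THIS CYCLE: **no kill**.  Index of what is below (prose only in docstrings):

* §1 `Body`, `orthogonalOhm_iff` — the crux body isolated once (byte-identical `let`-gadgets), so that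
  hypothesis-dropped variants can be stated without re-copying; `orthogonalOhm_iff_allLengths` (PROVED):
  the side condition `2 ≤ N` is decoration (chains of length `≤ 1` have no bond, `J ≡ 0`, every contact
  response is `0`), information for provers only.
* §2 LOAD-BEARING ANALYSIS.  `OrthogonalOhmWithoutAnharmonicity` (`lam = β = 0` admitted) is FALSE in
  substance (harmonic member ballistic: `ρ_b ≥`-average `T²D_N ~ N`), recorded as the near-miss
  `orthogonalOhm_false_without_anharmonicity` (sorry; obstruction = three unfiled harmonic-point facts, see
  its docstring) whose abstract core IS proved: `conductance_le_of_rowConstancy_backflow_bound` (§3).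
  `0 < γ` (no baths ⇒ `H` conserved, `G(s) ~ s⁻¹`, no limiting absorption) and `0 < ω₂ ∧ 0 < lam`
  (unpinned FPU-β: anomalous, itself open) are discussed in docstrings; `0 < T` only feeds the tree's
  Gibbs objects.  Nothing in the hypothesis list is removable except `2 ≤ N`.
* §3 ABSTRACT SCHUR-GADGET FACTS (all PROVED, Mathlib only): `schur_eq_lap_of_not_isUnit_det` (the junk
  branch `G(s)⁻¹ = 0`: what "the limit exists" silently means if `det G(s) = 0`; excluded for `s > 0` by
  `FeshbachIdentities` (iv), for `s = 0` by nobody — the line's stubs R2–R4 assert the limits directly);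
  `backflow_nonneg` / `schur_self_ge_lap_self` (time-reversal antisymmetry `lap(e,J) = −lap(J,e)` +
  `G` positive definite ⇒ `schur(J,J) ≥ lap(J,J)`, the inequality behind "⊇ HasBoundedResponse");
  `backflow_sign_needs_reversal` (1×1 witness: without the antisymmetry the inequality fails — so
  `FeshbachIdentities` (ii) is load-bearing for that remark); `conductance_le_of_rowConstancy_backflow_bound`
  (W1 row constancy + backflow ≥ 0 + `|ρ_b| ≤ C` ⇒ `T²D_N ≤ C`: the exact sense in which the boundedness
  clause contains `HasBoundedResponse`).
* §4 LINE `Sketch` (lead `prover-line-…-12693-0`, stubs R0–R4, S1, S2): R1, S1, S2 re-derived on paper at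
  every `s > 0` — EXACT as typed (no misstatement); joint sufficiency is the lead's kernel-checked
  `orthogonalOhm_proof`; `hiddenFixedN_remark`: R2–R4's limits need `det G(0) ≠ 0`, which NO route item
  supplies (`FeshbachIdentities` (iv) is `s > 0` only) — a fixed-`N` bracket lemma the line must add
  (load-bearing for the crux too: a singular `G(0)` would make `schur_s ~ −c/s`); `bulkRegression_of_rho_and_clamped` (PROVED, abstract) is the converse
  bookkeeping: modulo R1 and R3 the stub R2 is IMPLIED by the crux, so the line's only content beyond the
  crux is R3 (`ClampedContactDecay`) — and R4 is the crux's own contact conjunct.  R3's doubted ε-clause is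
  CONSISTENT with the discrete Robin network (docstring of `robinModel_remark`: `reg₀(b;a) = K` for all
  `b, a`; `ω₀ = −ω₁ = (K − ρ_b)/((N−1)γ) ≈ 2ℓK/(γN²)`, so `b·|ω₀(b)| ≲ 2ℓK/(γN) → 0`).
* §5 WHY IT RESISTS (docstring of `consolidation_remark`): modulo the fixed-`N` Ward dictionary W1–W5
  (`Cruxes/OrthogonalOhm/WardDictionary.md`) the crux is equivalent to CONVERGENCE of the open-chain
  conductivity `T²D_N` plus boundary concentration of ONE profile `a_N = G(0)⁻¹lap₀(e,J)`; i.e. it is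
  Fourier's law for `pinnedChain` in correlation form, expected TRUE (normal transport of pinned anharmonic
  chains) and open; a disproof would disprove the conjunct.  No parameter inside the hypotheses is
  computable (every object is a correlation of the anharmonic Langevin semigroup); the computable corners
  (harmonic, velocity-flip anchor j015200/j015230/j016197) lie outside the hypotheses or support the crux.

`lean check`: rc 0, 1 sorry (`orthogonalOhm_false_without_anharmonicity`, near-miss by design).
-/

namespace Summit.AtomisticToContinuum.FouriersLaw.Cruxes.OrthogonalOhm.Disproof

open MeasureTheory Filter Topology Matrix
open Summit.AtomisticToContinuum.FouriersLaw.Theses.HonestZwanzig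

/-! ## §1 The crux body, isolated -/

/-- The body of `OrthogonalOhm` at given parameters, temperature, constants `k, C`, tolerance `ε`,
boundary width `R` and length `N` — the `let`-gadgets are byte-identical to the route file, so that
`orthogonalOhm_iff` is `Iff.rfl`. -/
def Body (ω₂ lam β γ T k C ε : ℝ) (R N : ℕ) : Prop :=
  let P := Literature.MathematicalPhysics.KineticTheory.HeatConduction.pinnedChain ω₂ lam β γ; let X := Literature.MathematicalPhysics.KineticTheory.HeatConduction.PhaseSpace N; let μ : MeasureTheory.Measure X := P.gibbsMeasure N T; let corr : (X → ℝ) → (X → ℝ) → ℝ → ℝ := fun f g t => (∫ z, f z * (∫ y, g y ∂(P.transitionKernel N T T t.toNNReal z)) ∂μ) - (∫ z, f z ∂μ) * (∫ z, g z ∂μ); let lap : ℝ → (X → ℝ) → (X → ℝ) → ℝ := fun s f g => ∫ t in Set.Ioi (0 : ℝ), Real.exp (-(s * t)) * corr f g t; let e : Fin N → X → ℝ := fun x z => z.2 x ^ 2 / 2 + P.U (z.1 x) + ∑ j : Fin N, ((if j.val = x.val + 1 then P.V (z.1 j - z.1 x) / 2 else 0) + (if x.val = j.val + 1 then P.V (z.1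 x - z.1 j) / 2 else 0)); let G : ℝ → Matrix (Fin N) (Fin N) ℝ := fun s => Matrix.of fun x y => lap s (e x) (e y); let schur : ℝ → (X → ℝ) → (X → ℝ) → ℝ := fun s f g => lap s f g - ∑ x : Fin N, ∑ y : Fin N, lap s f (e x) * (G s)⁻¹ x y * lap s (e y) g; let J : X → ℝ := fun z => ∑ i : Fin N, P.bondCurrent N i z; (∀ b : Fin N, b.val + 1 < N → ∃ ρ : ℝ, Filter.Tendsto (fun s => schur s (P.bondCurrent N b) J) (nhdsWithin (0 : ℝ) (Set.Ioi 0)) (nhds ρ) ∧ |ρ| ≤ C ∧ (R ≤ b.val → b.val + 2 + R ≤ N → |ρ - k| ≤ ε)) ∧ (∀ b : Fin N, (b.val = 0 ∨ b.val = N - 1) → ∃ w : ℝ, Filter.Tendsto (fun s => schur s (fun z => z.2 b ^ 2) J) (nhdsWithin (0 : ℝ) (Set.Ioi 0)) (nhds w) ∧ |w| ≤ C)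

/-- The crux, read through `Body` (definitional). -/
theorem orthogonalOhm_iff :
    OrthogonalOhm ↔ ∀ ω₂ lam β γ : ℝ, 0 < ω₂ → 0 < lam → 0 < β → 0 < γ → ∀ T : ℝ, 0 < T →
      ∃ k C : ℝ, ∀ ε : ℝ, 0 < ε → ∃ R : ℕ, ∀ N : ℕ, 2 ≤ N → Body ω₂ lam β γ T k C ε R N :=
  Iff.rfl

/-- Chains of length `N ≤ 1` have no bond: every `bondCurrent N i` vanishes identically. -/
theorem bondCurrent_eq_zero_of_lt_two (ω₂ lam β γ : ℝ) {N : ℕ} (hN : N < 2) (i : Fin N)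
    (z : Literature.MathematicalPhysics.KineticTheory.HeatConduction.PhaseSpace N) :
    (Literature.MathematicalPhysics.KineticTheory.HeatConduction.pinnedChain ω₂ lam β γ).bondCurrent N i z
      = 0 := by
  unfold Literature.MathematicalPhysics.KineticTheory.HeatConduction.OscillatorChain.bondCurrent
  refine Finset.sum_eq_zero fun j _ => ?_
  have hj := j.isLt
  have hi := i.isLt
  rw [if_neg (by omega)]

/-- DEGENERATE LENGTHS ARE HARMLESS: for `N ≤ 1` the body holds for every `k, ε, R` and every `C ≥ 0`
(no bond, so the bond clause is empty; `J ≡ 0`, so `corr(·, J) ≡ 0`, `lap_s(·, J) = 0`,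
`schur_s(p_b², J) = 0` and the contact responses are the constant `0`).  Hence the route's side
condition `2 ≤ N` is decoration (`orthogonalOhm_iff_allLengths`). -/
theorem body_of_lt_two {ω₂ lam β γ T k C ε : ℝ} {R N : ℕ} (hN : N < 2) (hC : 0 ≤ C) :
    Body ω₂ lam β γ T k C ε R N := by
  unfold Body
  intro P X μ corr lap e G schur J
  have hJ0 : ∀ z, J z = 0 := fun z =>
    Finset.sum_eq_zero fun i _ => bondCurrent_eq_zero_of_lt_two ω₂ lam β γ hN i z
  have hcorr : ∀ (g : X → ℝ) (t : ℝ), corr g J t = 0 := by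
    intro g t
    show (∫ z, g z * (∫ y, J y ∂(P.transitionKernel N T T t.toNNReal z)) ∂μ)
        - (∫ z, g z ∂μ) * (∫ z, J z ∂μ) = 0
    simp [hJ0]
  have hlap : ∀ (s : ℝ) (g : X → ℝ), lap s g J = 0 := by
    intro s g
    show (∫ t in Set.Ioi (0 : ℝ), Real.exp (-(s * t)) * corr g J t) = 0
    simp [hcorr]
  have hschur : ∀ (s : ℝ) (g : X → ℝ), schur s g J = 0 := by
    intro s g
    show lap s g J - ∑ x : Fin N, ∑ y : Fin N, lap s g (e x) * (G s)⁻¹ x y * lap s (e y) J = 0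
    simp [hlap]
  refine ⟨fun b hb => ?_, fun b _ => ⟨0, ?_, by simpa using hC⟩⟩
  · exact absurd hb (by have := b.isLt; omega)
  · simp only [hschur]
    exact tendsto_const_nhds

/-- `2 ≤ N` IS DECORATION: the crux is equivalent to the same statement over ALL lengths `N`
(for `N ≥ 2` nothing changes; `N ≤ 1` is `body_of_lt_two`, the needed `0 ≤ C` being forced by the
bond `b = 0` of the `N = 2` instance).  Information for provers; not a defect. -/
theorem orthogonalOhm_iff_allLengths :
    OrthogonalOhm ↔ ∀ ω₂ lam β γ : ℝ, 0 < ω₂ → 0 < lam → 0 < β → 0 < γ → ∀ T : ℝ, 0 < T →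
      ∃ k C : ℝ, ∀ ε : ℝ, 0 < ε → ∃ R : ℕ, ∀ N : ℕ, Body ω₂ lam β γ T k C ε R N := by
  rw [orthogonalOhm_iff]
  constructor
  · intro h ω₂ lam β γ hω hl hβ hγ T hT
    obtain ⟨k, C, hkC⟩ := h ω₂ lam β γ hω hl hβ hγ T hT
    refine ⟨k, C, fun ε hε => ?_⟩
    obtain ⟨R, hR⟩ := hkC ε hε
    have hC : 0 ≤ C := by
      obtain ⟨ρ, -, hρ, -⟩ := (hR 2 le_rfl).1 ⟨0, by norm_num⟩ (by norm_num)
      exact (abs_nonneg ρ).trans hρ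
    refine ⟨R, fun N => ?_⟩
    by_cases hN : 2 ≤ N
    · exact hR N hN
    · exact body_of_lt_two (by omega) hC
  · intro h ω₂ lam β γ hω hl hβ hγ T hT
    obtain ⟨k, C, hkC⟩ := h ω₂ lam β γ hω hl hβ hγ T hT
    refine ⟨k, C, fun ε hε => ?_⟩
    obtain ⟨R, hR⟩ := hkC ε hε
    exact ⟨R, fun N _ => hR N⟩

/-! ## §2 Load-bearing analysis -/

/-- The crux with the anharmonicity hypotheses weakened to `0 ≤ lam`, `0 ≤ β` (so the harmonic member
`pinnedChain ω₂ 0 0 γ` is admitted). -/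
def OrthogonalOhmWithoutAnharmonicity : Prop :=
  ∀ ω₂ lam β γ : ℝ, 0 < ω₂ → 0 ≤ lam → 0 ≤ β → 0 < γ → ∀ T : ℝ, 0 < T →
    ∃ k C : ℝ, ∀ ε : ℝ, 0 < ε → ∃ R : ℕ, ∀ N : ℕ, 2 ≤ N → Body ω₂ lam β γ T k C ε R N

/-- NEAR-MISS (not closed; "any proof must use `0 < lam ∧ 0 < β`").  At `lam = β = 0` the chain is the
pinned HARMONIC chain, whose open-chain conductivity is ballistic: `T²D_N = (N−1)c_N`, `c_N → c_∞ > 0`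
(`Literature.Barriers.AtomisticToContinuum.HarmonicChainBallisticFlux`, vendored fact, with the PROVED
corollary `HarmonicChainBallisticFlux.not_hasBoundedResponse : ¬ HasBoundedResponse (pinnedChain ω₂ 0 0 γ)`).
By `conductance_le_of_rowConstancy_backflow_bound` (§3) the boundedness clause `|ρ_b| ≤ C` forces
`T²D_N ≤ C` as soon as (W1) `lap₀(j_b, J) = T²D_N` for every bond and (backflow) `Σ_b (ρ_b − lap₀(j_b,J)) ≥ 0`
hold — so the statement is false at the harmonic corner.  OBSTRUCTION to a kernel proof: none of the three
inputs is in the tree at `(ω₂, 0, 0, γ)` — (1) the open-chain Green–Kubo identity `OpenChainGreenKubo` is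
typed and proved only under `0 < lam`, `0 < β`; (2) the fixed-`N` Feshbach package (`FeshbachIdentities`:
`L¹` correlations, time reversal, Kolmogorov identities — giving W1 and the antisymmetry behind
`backflow_nonneg`) is an OPEN support item even inside the hypotheses; (3) `HarmonicChainBallisticFlux` is a
named fact, not a theorem.  A Gaussian (Lyapunov-equation) evaluation of the tree's `transitionKernel` at the
harmonic point would settle (1)–(2) but needs the identification `transitionKernel = OU kernel`
(`LinearLangevinGaussian.lean` covers the linear SDE class; the bridge to `pinnedChain ω₂ 0 0 γ` is unfiled).
Numerically (refuter rattack j003954, lead j016197): `ρ_mid ~ N` at the harmonic corner, as expected. -/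
theorem orthogonalOhm_false_without_anharmonicity : ¬ OrthogonalOhmWithoutAnharmonicity := by
  sorry

/-- REMARK (`0 < γ`, no theorem).  At `γ = 0` the baths decouple: `transitionKernel` is the deterministic
Hamiltonian flow, `H = Σ_x e_x` is conserved, so `Σ_y corr(e_x, e_y)(t) = Cov(e_x, H)` does not decay and
`G(s)·1 = Cov(e,H)/s`: the energy Gram matrix has an `s⁻¹` direction, `J = L W_c` exactly (no contact term),
`lap_s(j_b, J) = s·lap_s(j_b, W_c)`, and at fixed `N` the isolated anharmonic chain is not mixing (KAM tori),
so even the existence of the `s ↓ 0` limits is out of reach.  The hypothesis is load-bearing for every tree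
lemma used by the route (Gibbs uniqueness, exponential mixing, `IsSteadyState` theory), but a kernel
refutation of the `γ = 0` variant would need KAM-level input; not attempted. -/
theorem without_baths_remark : True := trivial

/-- REMARK (`0 < ω₂`, `0 < lam`: pinning).  Dropping BOTH (`U ≡ 0`) gives the momentum-conserving FPU-β
chain, whose conductivity is believed anomalous (`κ_N ~ N^{2/5}` or `N^{1/3}`; barrier
`Literature.Barriers.AtomisticToContinuum.FPUBetaKineticAnomaly`, kinetic-theory level) — so the variant is
believed FALSE but its falsity is itself an open problem; no kernel content.  Dropping only `0 < lam`
(harmonic pinning `ω₂ > 0`, quartic coupling `β > 0`): pinned FPU-β, believed NORMAL — `0 < lam` alone is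
possibly unnecessary for the truth of the crux, though the tree's NESS/Gibbs lemmas are proved under it
(CEHR C1–C5 need interaction degree ≥ pinning degree, fine either way). Information for the planner. -/
theorem without_pinning_remark : True := trivial

/-! ## §3 Abstract facts about the Schur gadget `schur = lap − lap(·,e) G⁻¹ lap(e,·)` -/

section gadget

variable {X : Type*} {N : ℕ}

/-- The route's Schur gadget over an arbitrary pairing `lap` and profile observables `e`. -/
noncomputable def schurOf (lap : (X → ℝ) → (X → ℝ) → ℝ) (e : Fin N → X → ℝ) (f g : X → ℝ) : ℝ :=
  lap f g - ∑ x : Fin N, ∑ y : Fin N,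
    lap f (e x) * (Matrix.of fun x y => lap (e x) (e y))⁻¹ x y * lap (e y) g

/-- JUNK BRANCH.  If the energy Gram matrix `G = [lap(e_x, e_y)]` is singular, Mathlib's `Matrix.inv`
returns `0` and the "Schur complement" silently degenerates to the unprojected pairing `lap f g`: the crux's
`Tendsto (fun s => schur s (j_b) J) …` would then be a statement about the FULL dynamics.  For `s > 0` this
branch is excluded by `FeshbachIdentities` (iv) (`G(s)` positive definite); at `s = 0` no route item asserts
`det G(0) ≠ 0` (the refuter rattack note sketches the hypoelliptic bracket argument: `G(0)ξ = 0 ⇒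
(−L)⁻¹(ξ·ẽ)` independent of `p_0, p_{N−1}` ⇒ `ξ_0 = 0` ⇒ `ξ_1 = 0` (`V'/V''` non-constant) ⇒ … ⇒ `ξ = 0`),
and the statement only ever evaluates `G(s)⁻¹` at `s > 0`, so `G(0)` never literally occurs: invertibility
of `G(0)` is a convenience for the line's limits (R2–R4), not a clause of the crux. -/
theorem schur_eq_lap_of_not_isUnit_det (lap : (X → ℝ) → (X → ℝ) → ℝ) (e : Fin N → X → ℝ)
    (hG : ¬ IsUnit (Matrix.of fun x y => lap (e x) (e y)).det) (f g : X → ℝ) :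
    schurOf lap e f g = lap f g := by
  unfold schurOf
  rw [Matrix.nonsing_inv_apply_not_isUnit _ hG]
  simp

/-- BACKFLOW IS NON-NEGATIVE under time-reversal antisymmetry.  Abstractly: for a positive definite real
matrix `G` and a row `Λ` (think `Λ_x = lap_s(J, e_x)`), the coupling term with the column `−Λ`
(think `lap_s(e_x, J) = −lap_s(J, e_x)`, opposite parities under `Θ`, `FeshbachIdentities` (ii)) satisfies
`−Σ_{x,y} Λ_x (G⁻¹)_{xy} (−Λ_y) = Λᵀ G⁻¹ Λ ≥ 0`. -/
theorem backflow_nonneg (G : Matrix (Fin N) (Fin N) ℝ) (hG : G.PosDef) (Λ : Fin N → ℝ) :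
    0 ≤ ∑ x : Fin N, ∑ y : Fin N, Λ x * G⁻¹ x y * Λ y := by
  have h := hG.inv.posSemidef.dotProduct_mulVec_nonneg Λ
  have hsum : ∑ x : Fin N, ∑ y : Fin N, Λ x * G⁻¹ x y * Λ y = Λ ⬝ᵥ (G⁻¹ *ᵥ Λ) := by
    simp only [dotProduct, Matrix.mulVec, Finset.mul_sum, mul_assoc]
  rw [hsum]
  simpa using h

/-- Consequently `schur(J,J) ≥ lap(J,J)` whenever the second-slot couplings are the negatives of the
first-slot ones and `G` is positive definite — the inequality quoted in the crux docstring
("`schur_s(J,J) ≥ lap_s(J,J)` (time reversal), `Σ_b ρ_b ≥ (N−1)T²D_N`"). -/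
theorem schur_self_ge_lap_self (G : Matrix (Fin N) (Fin N) ℝ) (hG : G.PosDef) (a : ℝ) (Λ Λ' : Fin N → ℝ)
    (hrev : ∀ x, Λ' x = -Λ x) :
    a ≤ a - ∑ x : Fin N, ∑ y : Fin N, Λ x * G⁻¹ x y * Λ' y := by
  have h := backflow_nonneg G hG Λ
  have : ∑ x : Fin N, ∑ y : Fin N, Λ x * G⁻¹ x y * Λ' y
      = -∑ x : Fin N, ∑ y : Fin N, Λ x * G⁻¹ x y * Λ y := by
    simp only [hrev, mul_neg, Finset.sum_neg_distrib]
  linarith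

/-- TIME REVERSAL IS LOAD-BEARING for that inequality: without the antisymmetry `Λ' = −Λ` the Schur
correction can have either sign (1×1 witness `G = 1`, `Λ = Λ' = 1`: `schur = lap − 1 < lap`).  So the
remark "`|ρ_b| ≤ C` ⊇ HasBoundedResponse" genuinely consumes `FeshbachIdentities` (ii). -/
theorem backflow_sign_needs_reversal :
    ¬ ∀ (a Λ Λ' g : ℝ), 0 < g → a ≤ a - Λ * g⁻¹ * Λ' := by
  intro h
  have := h 0 1 1 1 one_pos
  norm_num at this

/-- THE EXACT SENSE OF "⊇ HasBoundedResponse" (abstract core of the near-miss of §2 and of the consolidation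
of §5).  At one length with `n ≥ 1` bonds: if the FULL-dynamics DC responses are Kirchhoff-flat,
`lap₀(j_b, J) = κ` for every bond (W1, `κ = T²D_N`), the backflow `Σ_b (ρ_b − lap₀(j_b,J))` is `≥ 0`
(`schur_self_ge_lap_self` summed), and the crux's clause `|ρ_b| ≤ C` holds for every bond, then `κ ≤ C`.
Feeding `κ = T²D_N` unbounded (harmonic corner) contradicts it; feeding the crux gives
`sup_N T²D_N ≤ C`. -/
theorem conductance_le_of_rowConstancy_backflow_bound {n : ℕ} (hn : 0 < n) (κ C : ℝ) (ρ lapJ : Fin n → ℝ)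
    (hW1 : ∀ b, lapJ b = κ) (hback : 0 ≤ ∑ b, (ρ b - lapJ b)) (hC : ∀ b, |ρ b| ≤ C) : κ ≤ C := by
  have hsum : ∑ b : Fin n, (ρ b - lapJ b) = (∑ b : Fin n, ρ b) - n * κ := by
    simp only [Finset.sum_sub_distrib, hW1, Finset.sum_const, Finset.card_univ, Fintype.card_fin,
      nsmul_eq_mul]
  have hρ : ∑ b : Fin n, ρ b ≤ n * C := by
    calc ∑ b : Fin n, ρ b ≤ ∑ _b : Fin n, C := Finset.sum_le_sum fun b _ => (le_abs_self _).trans (hC b)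
      _ = n * C := by simp
  have hn' : (0 : ℝ) < n := by exact_mod_cast hn
  nlinarith

end gadget

/-! ## §4 Line `Sketch` (targets: stubs R1 `stub_regressionIdentity`, R2 `stub_bulkRegressionOhm`,
R3 `stub_clampedContactDecay`, R4 `stub_contactResponses`, S1 `stub_wardIdentity`, S2 `stub_rowIdentity`) -/

/-- CONVERSE BOOKKEEPING OF THE LINE (abstract, proved): from the regression identity R1 at origin `a = b`,
`ρ = r − bγω₀ + (N−1−b)γω₁`, the regression term satisfies
`|r − k| ≤ |ρ − k| + γ·(b|ω₀| + (N−1−b)|ω₁|)`.  Hence, MODULO R1 and R3 (`ClampedContactDecay`), stub R2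
(`BulkRegressionOhm`) is implied by the crux itself (same `k`; `C₂ ≤ C + 2γC₃`, `ε`-bookkeeping as in the
lead's `orthogonalOhm_proof` run backwards): the line `Sketch` adds to the crux EXACTLY the content of R3
(plus the fixed-`N` identities R1/S1/S2 and the route item R0).  A refutation of R2 alone is therefore
impossible without refuting the crux or R3; R3 is the stub to attack (see `robinModel_remark`). -/
theorem bulkRegression_of_rho_and_clamped (ρ r k γ ω₀ ω₁ b M : ℝ) (hγ : 0 ≤ γ) (hb : 0 ≤ b) (hM : 0 ≤ M)
    (hR1 : ρ = r - b * γ * ω₀ + M * γ * ω₁) :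
    |r - k| ≤ |ρ - k| + γ * (b * |ω₀| + M * |ω₁|) := by
  have hr : r - k = (ρ - k) + b * γ * ω₀ - M * γ * ω₁ := by rw [hR1]; ring
  rw [hr]
  have h1 : |b * γ * ω₀| = γ * (b * |ω₀|) := by
    rw [abs_mul, abs_mul, abs_of_nonneg hb, abs_of_nonneg hγ]; ring
  have h2 : |M * γ * ω₁| = γ * (M * |ω₁|) := by
    rw [abs_mul, abs_mul, abs_of_nonneg hM, abs_of_nonneg hγ]; ring
  calc |ρ - k + b * γ * ω₀ - M * γ * ω₁|
      ≤ |ρ - k + b * γ * ω₀| + |M * γ * ω₁| := abs_sub _ _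
    _ ≤ |ρ - k| + |b * γ * ω₀| + |M * γ * ω₁| := by gcongr; exact abs_add_le _ _
    _ = |ρ - k| + γ * (b * |ω₀| + M * |ω₁|) := by rw [h1, h2]; ring

/-- STUB AUDIT (paper, every `s > 0`, modulo linearity/integrability from `FeshbachIdentities` (i)):
* R1 `stub_regressionIdentity`: with `X_a = Σ_x (x−a)e_x`, `GeneratorSiteEnergy` summed against `x − a`
  gives `J = L X_a + aγ(T − p_0²) − (N−1−a)γ(T − p²_{N−1})` (the non-bond `b = N−1` contributes
  `bondCurrent N (N−1) ≡ 0`); Kolmogorov (iii) `lap_s(f, L h) = s·lap_s(f,h) − cov(f,h)` in BOTH slots of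
  the gadget makes the two `s`-terms cancel identically: `schur_s(j_b, L X_a) = reg_s(b;a)` EXACTLY (parity
  kills `cov(j_b, X_a)`), and `schur_s(j_b, const) = 0`.  ⇒ R1 as typed is right, including signs.
* S1 `stub_wardIdentity`: Kolmogorov (iii) first form with `g = L e_y`, `ParityStatics`
  (`cov(e_x, L e_y) = −Γ_{xy}`), rows/columns `lap_s((Le_x)∘Θ, e_u) = lap_s(e_u, L e_x) = sG_{xu} − χ_{xu}`:
  `schur = s²G − sχ + Γ − (sG − χ)G⁻¹(sG − χ) = sχ + Γ − χG⁻¹χ`.  ⇒ exact as typed.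
* S2 `stub_rowIdentity`: `(L e_y)∘Θ = Σ_b([b=y] − [y=b+1]) j_b + γ[y∈∂](T − p_y²)`; pairing with `J`
  and subtracting the projection gives `(χ G(s)⁻¹ Ψ_s)_y`, `Ψ_s = lap_s(e, J)`.  ⇒ exact as typed
  (coefficient `−γ([y=0]+[y=N−1])` on `schur_s(p_y², J)` included).
* R4 `stub_contactResponses` is the crux's second conjunct verbatim (necessary, no loss).
* Joint sufficiency: the lead's `orthogonalOhm_proof` composes R0–R4 into the crux BY NAME (kernel-checked
  in `Lines/Sketch.lean`); no smuggled gap — but note R0 = route item `FeshbachIdentities` (stmt-12697,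
  open) is consumed by R1, so the line closes the crux modulo that support item. -/
theorem stubAudit_remark : True := trivial

/-- HIDDEN FIXED-`N` LEMMA IN THE LINE (stub-gap, posted to the item as `stubs/G0Invertibility.md`).
Stubs R2, R3, R4 each assert the EXISTENCE of `s ↓ 0` limits (`reg_s(b;b)`, `schur_s(j_b, p_0²)`,
`schur_s(j_b, p²_{N−1})`, `schur_s(p_b², J)`).  At fixed `N` these follow from (a) `lap_s → lap₀` entrywise
(dominated convergence from `L¹` correlations, `FeshbachIdentities` (i)) and (b) `G(s)⁻¹ → G(0)⁻¹`, which
needs `det G(0) ≠ 0`.  Route item `FeshbachIdentities` (iv) gives `G(s)` positive definite for `s > 0` ONLY;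
the limit `s ↓ 0` yields positive SEMI-definiteness of `G(0)`, no more.  Definiteness of
`G(0) = [⟨ẽ_x, (−L)⁻¹ẽ_y⟩_μ]` is the Dirichlet-form statement `⟨f,(−L)⁻¹f⟩ = γT Σ_{b∈∂} ‖∂_{p_b}(−L)⁻¹f‖² > 0`
for `0 ≠ f ∈ span ẽ`, i.e. "`(−L)⁻¹f` independent of `p_0, p_{N−1}` forces `f = 0`" — a hypoelliptic
bracket induction (`∂_{p_0} ⇒ ξ_0 = 0` from the `p_0²/2` in `e_0`; `∂_{q_0} ⇒ ξ_1 = 0` because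
`V'/V'' = (r + βr³)/(1 + 3βr²)` is non-constant; …) that is in NO route item as typed (the planner lists it
under NOT DECOMPOSED YET).  If `G(0)` WERE singular at some `N` with `lap₀(j_b, e)` not orthogonal to the
kernel, `schur_s(j_b, J) ~ −c/s` and the crux would fail at that `N` for every `C` — so this fixed-`N` lemma is
load-bearing for the crux itself, not only for the line; the bracket argument says it holds for all
parameters (no parameter-tuned counterexample), but a prover of R2–R4 must supply it.  Suggested support
stub for the lead: `G0PosDef : FeshbachIdentities → ∀ …, ∀ ξ ≠ 0, 0 < Σ ξ_x ξ_y lim_{s↓0} G(s)_{xy}`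
(or fold it into a strengthened (iv)). -/
theorem hiddenFixedN_remark : True := trivial

/-- R3 UNDER THE DISCRETE ROBIN NETWORK (heuristic model computation, recorded for the lead who doubts R3's
shape).  Model the DC Feshbach matrix by the local Robin network `𝔽 = K(−Δ_Neumann) + g(δ₀δ₀ᵀ + δ_{N−1}δ_{N−1}ᵀ)`
(bulk bond conductance `K = k`, contact conductance `g`, Robin length `ℓ = K/g`; asymmetric contacts
`g_L ≠ g_R` allowed), the splitting W2 by `χ⁻¹h_L = u_L` = left-exit (harmonic-measure) profile
`u_L(y) = (ℓ_R + N−1−y)/(ℓ_L + ℓ_R + N−1)`, and `Φ_b = h_L − χ1_{≤b}`.  Then for EVERY bond `b` and EVERY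
origin `a`:  `reg₀(b;a) = (χ⁻¹Φ_b)ᵀ 𝔽 (z − a) = [ℓ_L(K + a g_L) + ℓ_R(K + (N−1−a)g_R)]/(ℓ_L+ℓ_R+N−1) = K`
identically (the `a`-dependence cancels through `ℓ g = K` at each end).  Consequences in the model:
(i) R2 holds with `r_b = K = k` exactly — the regression term is the cleanest carrier of `k`;
(ii) by R1 at `a = 0` and `a = N−1`, `ω₀ = −ω₁` and `ρ_b − K = −(N−1)γω₀(b)`, so
`ω₀(b) = (K − ρ_b)/((N−1)γ) ≈ (K − T²D_N)/((N−1)γ) ≈ 2ℓK/(γN²) > 0` (finite-size contact deficit of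
`D_N`), b-INDEPENDENT at leading order; (iii) hence R3's weighted responses `b·|ω₀(b)| ≲ 2ℓK/(γN) → 0`
uniformly — R3's doubted ε-clause is CONSISTENT with diffusive phenomenology (the lead's worry "c/N × b ~ N/2
= O(1)" is averted because the two leading `1/N` contributions to `ω₀` cancel by the Robin-length identity
`ℓ g = K`).  What could still break R3 for the anharmonic chain: non-local corrections to `𝔽(0)` (algebraic
off-diagonal tails of the bond kernel `𝔎_N(0)`, predicted `~ z⁻²` by card pair-field-feshbach-peel) enter
`ω₀(b)` at the next order; tails `~ z⁻¹` (non-summable, i.e. anomalous transport) would be needed to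
violate `b·|ω₀(b)| → 0`.  So within normal transport R3 stands; it is not refutable cheaply. -/
theorem robinModel_remark : True := trivial

/-! ## §5 Why the crux resists -/

/-- CONSOLIDATION (why no kill is available, and what a kill would mean).  Fixed `N`, all `s ↓ 0` limits
existing (Feshbach package + `G(0)` invertible): the zero-frequency Ward dictionary
(`Cruxes/OrthogonalOhm/WardDictionary.md`, W1–W5; R1/S2 are its finite-`s` forms) DISSOLVES the orthogonal
dynamics: `ρ_b = T²D_N − Φ_bᵀ a_N` with `Φ_b = h_L − χ1_{≤b}` (bounded, `O(dist/N)` near the far ends) and ONE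
profile `a_N = G(0)⁻¹ lap₀(e, J)`, `Σ_b(ρ_b − T²D_N) = ΨᵀG(0)⁻¹Ψ ≥ 0`.  If `a_N` is boundary-concentrated with
`N`-uniform mass (diffusive phenomenology: `a_N` is the energy-profile initial datum transport-equivalent to a
uniform current kick — depletion at the left contact layer, accumulation at the right), then
bulk `ρ_b = T²D_N + O((R+ℓ)/N)` and the contact responses are `T²D_N/γ + O(1)`; so
  boundedness clause ⟺ `sup_N T²D_N < ∞` (= HasBoundedResponse level, cf.
  `conductance_le_of_rowConstancy_backflow_bound`), and
  homogeneity clause (one `k`, `R = R(ε)`) ⟺ CONVERGENCE of `T²D_N` (`k = T²κ(T)`; `R(ε)` absorbs the rate).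
That is: modulo fixed-`N` identities the crux is Fourier's law for `pinnedChain` in correlation form
(route item `MemoryConductivity`), expected TRUE for pinned anharmonic chains (normal transport: BLR 2000 §10,
Aoki–Kusnezov φ⁴, Lepri–Livi–Politi 2003 §6) and open; a refutation would refute the conjunct `FouriersLaw`.
No instance inside the hypotheses (`lam, β, ω₂, γ, T > 0`) is computable — every object is an equilibrium
correlation of the anharmonic Langevin semigroup — and the computable corners are either outside the
hypotheses (harmonic: FALSE there, §2) or exactly solvable diffusive anchors that SUPPORT the crux
(velocity-flip harmonic chain, jobs j015200/j015230/j016197: `ρ_mid` N-independent to 6 digits, exponential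
locality, bounded contact rows).  Cheap attacks run this cycle: degenerate lengths (decoration), junk branch
of `Matrix.inv` (unreachable for `s > 0`), quantifier order (matches the informal text; `R` before `N`),
sign/normalisation audit of R1/S1/S2 (exact), hypothesis mutation (only `2 ≤ N` removable; `0 < lam` alone
possibly unnecessary), Robin-model test of R3 (consistent), barrier scan (HarmonicCrystalBallistic,
MazurBoundBallistic(+OpenChain), SpectralGapClosing(+Equilibrium), StrongPinningBreathers,
FixedLengthNoConductivityControl, LowTemperatureWeakAnharmonicity, FPUBetaKineticAnomaly: none bites inside the
hypotheses; gap closing is embraced by the Schur complement), negatives index (no FouriersLaw entry). -/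
theorem consolidation_remark : True := trivial

end Summit.AtomisticToContinuum.FouriersLaw.Cruxes.OrthogonalOhm.Disproof
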